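import Literature.Barriers.NavierStokesRegularity.NavierStokesInequalityArrangement
import HarnessLib

/-!
# Planar partial derivatives and the operator `L` along smooth families (parameter calculus)

Barrier catalogue support file for `NavierStokesRegularity` (D-0021), on the discharge path of
fact D-II `Literature.Barriers.NavierStokesRegularity.NSIProfiles_of_arrangement`
(`NavierStokesInequalityProfiles`; W. S. Ożański, arXiv:1709.00602v4, §4.1). The construction
of the profiles `h_{i,t}` (Lemma 4.1) and `qᵏ_{i,t}` ((4.16)) manipulates planar functions
depending smoothly on parameters — time `t`, the slack `δ`, the direction factor `b` — and
differentiates them in the plane: `∇h²_{i,t}`, `∇p[aⱼᵏ(t)vⱼ, h_{j,t}]` inside the time integral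
(4.16), `L(h_{i,t}) > 0` in Lemma 4.1 ("since both `f₁` and `φ₁` are smooth on `P` we immediately
obtain the required smoothness of `h₁` and that `(v₁,h_{1,t},φ₁)` is a structure"), `D^l qᵏ` in
(4.18). This file records the generic calculus facts behind "immediately", for families
`P : E → ℝ² → F` jointly `C^∞` on an open set `Ω ⊆ E × ℝ²` of (parameter, point):

* `derivR_eq_fderiv_uncurry`, `derivZ_eq_fderiv_uncurry` — the planar partials of a slice are
  values of the joint derivative;
* `ContDiffOn.derivR_param`, `….derivZ_param` (and the global `ContDiff` versions) — the planar
  partials `(e,q) ↦ ∂ᵣ(P e)(q)`, `∂_z(P e)(q)` are again jointly `C^∞` on `Ω`; iterating,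
  `….derivR_derivR_param` etc.;
* `ContDiffOn.continuousOn_opL_param` — `(e,q) ↦ L(P e)(q)` is continuous on `Ω` off the axis
  (`L f = ∂ᵣ∂ᵣf + ∂_z∂_zf + r⁻¹∂ᵣf - f/r²`, Ożański (3.15));
* `exists_forall_opL_gt_of_compact` — the compactness step of Lemma 4.1 made explicit: if
  `L(P 0) ≥ c₀ > 0` on a compact `K ⊆ P` with `{0} × K ⊆ Ω`, then `L(P e) > c₀/2` on `K` for all
  parameters `e` in a ball around `0` (generalized tube lemma).

## Mathlib search

`hasFDerivAt_prodMk_right`, `ContDiffOn.fderiv_of_isOpen`, `ContDiffOn.clm_apply`,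
`generalized_tube_lemma`, `Metric.isOpen_iff` (used).

## References

* W. S. Ożański, *On weak solutions to the Navier–Stokes inequality with internal
  singularities*, arXiv:1709.00602v4, §3.3 (3.15), Lemma 4.1 (proof), §4.1 (4.16)–(4.18).
  [`Ozanski2017NSISingular`]
-/

noncomputable section

open Set Function Filter Topology Metric
open scoped ContDiff

namespace Literature.Barriers.NavierStokesRegularity

variable {E : Type*} [NormedAddCommGroup E] [NormedSpace ℝ E]
  {F : Type*} [NormedAddCommGroup F] [NormedSpace ℝ F]

/-! ### Planar partials of a slice through the joint derivative -/

/-- `∂ᵣ(P e)(q) = D(uncurry P)(e,q)(0,(1,0))` when the family is differentiable at `(e,q)`.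
[folklore] -/
theorem derivR_eq_fderiv_uncurry {P : E → ℝ × ℝ → F} {e : E} {q : ℝ × ℝ}
    (hP : DifferentiableAt ℝ (uncurry P) (e, q)) :
    derivR (P e) q = fderiv ℝ (uncurry P) (e, q) (0, (1, 0)) := by
  have h1 : HasFDerivAt (fun q' : ℝ × ℝ => (e, q')) (ContinuousLinearMap.inr ℝ E (ℝ × ℝ)) q :=
    hasFDerivAt_prodMk_right e q
  have h2 := hP.hasFDerivAt.comp q h1
  rw [derivR, show P e = uncurry P ∘ fun q' : ℝ × ℝ => (e, q') from rfl, h2.fderiv]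
  simp

/-- `∂_z(P e)(q) = D(uncurry P)(e,q)(0,(0,1))` when the family is differentiable at `(e,q)`.
[folklore] -/
theorem derivZ_eq_fderiv_uncurry {P : E → ℝ × ℝ → F} {e : E} {q : ℝ × ℝ}
    (hP : DifferentiableAt ℝ (uncurry P) (e, q)) :
    derivZ (P e) q = fderiv ℝ (uncurry P) (e, q) (0, (0, 1)) := by
  have h1 : HasFDerivAt (fun q' : ℝ × ℝ => (e, q')) (ContinuousLinearMap.inr ℝ E (ℝ × ℝ)) q :=
    hasFDerivAt_prodMk_right e q
  have h2 := hP.hasFDerivAt.comp q h1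
  rw [derivZ, show P e = uncurry P ∘ fun q' : ℝ × ℝ => (e, q') from rfl, h2.fderiv]
  simp

/-! ### Planar partials of jointly smooth families are jointly smooth -/

section OnOpen

variable {P : E → ℝ × ℝ → F} {Ω : Set (E × (ℝ × ℝ))}

/-- **`(e,q) ↦ ∂ᵣ(P e)(q)` is jointly `C^∞` on an open set where `P` is.** [folklore] -/
theorem _root_.ContDiffOn.derivR_param (hP : ContDiffOn ℝ ∞ (uncurry P) Ω) (hΩ : IsOpen Ω) :
    ContDiffOn ℝ ∞ (fun p : E × (ℝ × ℝ) => derivR (P p.1) p.2) Ω := by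
  have hD : ContDiffOn ℝ ∞ (fun p => fderiv ℝ (uncurry P) p ((0 : E), ((1 : ℝ), (0 : ℝ)))) Ω :=
    (hP.fderiv_of_isOpen hΩ (m := ∞) (by simp)).clm_apply contDiffOn_const
  refine hD.congr fun p hp => ?_
  exact derivR_eq_fderiv_uncurry ((hP.contDiffAt (hΩ.mem_nhds hp)).differentiableAt (by simp))

/-- **`(e,q) ↦ ∂_z(P e)(q)` is jointly `C^∞` on an open set where `P` is.** [folklore] -/
theorem _root_.ContDiffOn.derivZ_param (hP : ContDiffOn ℝ ∞ (uncurry P) Ω) (hΩ : IsOpen Ω) :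
    ContDiffOn ℝ ∞ (fun p : E × (ℝ × ℝ) => derivZ (P p.1) p.2) Ω := by
  have hD : ContDiffOn ℝ ∞ (fun p => fderiv ℝ (uncurry P) p ((0 : E), ((0 : ℝ), (1 : ℝ)))) Ω :=
    (hP.fderiv_of_isOpen hΩ (m := ∞) (by simp)).clm_apply contDiffOn_const
  refine hD.congr fun p hp => ?_
  exact derivZ_eq_fderiv_uncurry ((hP.contDiffAt (hΩ.mem_nhds hp)).differentiableAt (by simp))

/-- `(e,q) ↦ ∂ᵣ∂ᵣ(P e)(q)` is jointly `C^∞` on `Ω`. [folklore] -/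
theorem _root_.ContDiffOn.derivR_derivR_param (hP : ContDiffOn ℝ ∞ (uncurry P) Ω) (hΩ : IsOpen Ω) :
    ContDiffOn ℝ ∞ (fun p : E × (ℝ × ℝ) => derivR (derivR (P p.1)) p.2) Ω :=
  (hP.derivR_param hΩ).derivR_param (P := fun e q => derivR (P e) q) hΩ

/-- `(e,q) ↦ ∂_z∂_z(P e)(q)` is jointly `C^∞` on `Ω`. [folklore] -/
theorem _root_.ContDiffOn.derivZ_derivZ_param (hP : ContDiffOn ℝ ∞ (uncurry P) Ω) (hΩ : IsOpen Ω) :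
    ContDiffOn ℝ ∞ (fun p : E × (ℝ × ℝ) => derivZ (derivZ (P p.1)) p.2) Ω :=
  (hP.derivZ_param hΩ).derivZ_param (P := fun e q => derivZ (P e) q) hΩ

/-- `(e,q) ↦ ∂ᵣ∂_z(P e)(q)` is jointly `C^∞` on `Ω`. [folklore] -/
theorem _root_.ContDiffOn.derivR_derivZ_param (hP : ContDiffOn ℝ ∞ (uncurry P) Ω) (hΩ : IsOpen Ω) :
    ContDiffOn ℝ ∞ (fun p : E × (ℝ × ℝ) => derivR (derivZ (P p.1)) p.2) Ω :=
  (hP.derivZ_param hΩ).derivR_param (P := fun e q => derivZ (P e) q) hΩ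

/-- `(e,q) ↦ ∂_z∂ᵣ(P e)(q)` is jointly `C^∞` on `Ω`. [folklore] -/
theorem _root_.ContDiffOn.derivZ_derivR_param (hP : ContDiffOn ℝ ∞ (uncurry P) Ω) (hΩ : IsOpen Ω) :
    ContDiffOn ℝ ∞ (fun p : E × (ℝ × ℝ) => derivZ (derivR (P p.1)) p.2) Ω :=
  (hP.derivR_param hΩ).derivZ_param (P := fun e q => derivR (P e) q) hΩ

/-- **`(e,q) ↦ L(P e)(q)` is continuous on `Ω` off the axis** for a real family jointly `C^∞`
on the open set `Ω` (`Lf = ∂ᵣ∂ᵣf + ∂_z∂_zf + r⁻¹∂ᵣf - f/r²`, (3.15)).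
[cite: Ozanski2017NSISingular, §3.3 (3.15)] -/
theorem _root_.ContDiffOn.continuousOn_opL_param {P : E → ℝ × ℝ → ℝ}
    (hP : ContDiffOn ℝ ∞ (uncurry P) Ω) (hΩ : IsOpen Ω) :
    ContinuousOn (fun p : E × (ℝ × ℝ) => opL (P p.1) p.2) (Ω ∩ {p | p.2.1 ≠ 0}) := by
  have hRR := (hP.derivR_derivR_param hΩ).continuousOn.mono (inter_subset_left (t := {p | p.2.1 ≠ 0}))
  have hZZ := (hP.derivZ_derivZ_param hΩ).continuousOn.mono (inter_subset_left (t := {p | p.2.1 ≠ 0}))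
  have hR := (hP.derivR_param hΩ).continuousOn.mono (inter_subset_left (t := {p | p.2.1 ≠ 0}))
  have h0 := hP.continuousOn.mono (inter_subset_left (t := {p : E × (ℝ × ℝ) | p.2.1 ≠ 0}))
  have hr : ContinuousOn (fun p : E × (ℝ × ℝ) => p.2.1) (Ω ∩ {p | p.2.1 ≠ 0}) :=
    (continuous_fst.comp continuous_snd).continuousOn
  have hne : ∀ p ∈ Ω ∩ {p : E × (ℝ × ℝ) | p.2.1 ≠ 0}, p.2.1 ≠ 0 := fun p hp => hp.2
  have e : (fun p : E × (ℝ × ℝ) => opL (P p.1) p.2) = fun p =>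
      derivR (derivR (P p.1)) p.2 + derivZ (derivZ (P p.1)) p.2 + (p.2.1)⁻¹ * derivR (P p.1) p.2 -
        uncurry P p / p.2.1 ^ 2 := by
    funext p; rfl
  rw [e]
  exact ((hRR.add hZZ).add ((hr.inv₀ hne).mul hR)).sub
    (h0.div (hr.pow 2) fun p hp => pow_ne_zero 2 (hne p hp))

end OnOpen

/-! ### Global versions -/

section Global

variable {P : E → ℝ × ℝ → F}

/-- `(e,q) ↦ ∂ᵣ(P e)(q)` is `C^∞` for a `C^∞` family. [folklore] -/
theorem _root_.ContDiff.derivR_param (hP : ContDiff ℝ ∞ (uncurry P)) :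
    ContDiff ℝ ∞ (fun p : E × (ℝ × ℝ) => derivR (P p.1) p.2) :=
  contDiffOn_univ.1 (hP.contDiffOn.derivR_param isOpen_univ)

/-- `(e,q) ↦ ∂_z(P e)(q)` is `C^∞` for a `C^∞` family. [folklore] -/
theorem _root_.ContDiff.derivZ_param (hP : ContDiff ℝ ∞ (uncurry P)) :
    ContDiff ℝ ∞ (fun p : E × (ℝ × ℝ) => derivZ (P p.1) p.2) :=
  contDiffOn_univ.1 (hP.contDiffOn.derivZ_param isOpen_univ)

/-- Each slice `P e` of a `C^∞` family is `C^∞`. [folklore] -/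
theorem _root_.ContDiff.slice_param (hP : ContDiff ℝ ∞ (uncurry P)) (e : E) : ContDiff ℝ ∞ (P e) :=
  hP.comp (contDiff_prodMk_right e)

/-- `∂ᵣ(P e)(q) = D(uncurry P)(e,q)(0,(1,0))` everywhere, for a `C^∞` family. [folklore] -/
theorem _root_.ContDiff.derivR_eq_fderiv_uncurry (hP : ContDiff ℝ ∞ (uncurry P)) (e : E) (q : ℝ × ℝ) :
    derivR (P e) q = fderiv ℝ (uncurry P) (e, q) (0, (1, 0)) :=
  Literature.Barriers.NavierStokesRegularity.derivR_eq_fderiv_uncurry (hP.differentiable (by simp) _)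

/-- `∂_z(P e)(q) = D(uncurry P)(e,q)(0,(0,1))` everywhere, for a `C^∞` family. [folklore] -/
theorem _root_.ContDiff.derivZ_eq_fderiv_uncurry (hP : ContDiff ℝ ∞ (uncurry P)) (e : E) (q : ℝ × ℝ) :
    derivZ (P e) q = fderiv ℝ (uncurry P) (e, q) (0, (0, 1)) :=
  Literature.Barriers.NavierStokesRegularity.derivZ_eq_fderiv_uncurry (hP.differentiable (by simp) _)

end Global

/-! ### The compactness step of Lemma 4.1: `L` stays positive under small perturbations -/

/-- **Positivity of `L` persists for small parameters, uniformly on a compact set.** Let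
`P : E → ℝ² → ℝ` be jointly `C^∞` on an open `Ω`, `K ⊆ {r ≠ 0}` compact with `{0} × K ⊆ Ω`, and
`L(P 0) ≥ c₀` on `K` with `c₀ > 0`. Then there is `ρ > 0` such that `L(P e)(q) > c₀/2` for all
`‖e‖ < ρ`, `q ∈ K` (continuity of `(e,q) ↦ L(P e)(q)` and the generalized tube lemma) — the step
"`h_{2,t}` depends continuously on `δ` … if `δ > 0` is sufficiently small" of Lemma 4.1, for the
condition `Lf > 0` off `{φ = 1}` of Definition 3.3. [cite: Ozanski2017NSISingular, Lemma 4.1 (proof)] -/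
theorem exists_forall_opL_gt_of_compact {P : E → ℝ × ℝ → ℝ} {Ω : Set (E × (ℝ × ℝ))}
    (hP : ContDiffOn ℝ ∞ (uncurry P) Ω) (hΩ : IsOpen Ω) {K : Set (ℝ × ℝ)} (hK : IsCompact K)
    (hK0 : ∀ q ∈ K, q.1 ≠ 0) (hKΩ : ∀ q ∈ K, ((0 : E), q) ∈ Ω) {c₀ : ℝ} (hc₀ : 0 < c₀)
    (hc : ∀ q ∈ K, c₀ ≤ opL (P 0) q) :
    ∃ ρ > 0, ∀ e : E, ‖e‖ < ρ → ∀ q ∈ K, c₀ / 2 < opL (P e) q := by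
  set A : Set (E × (ℝ × ℝ)) :=
    (Ω ∩ {p | p.2.1 ≠ 0}) ∩ (fun p : E × (ℝ × ℝ) => opL (P p.1) p.2) ⁻¹' Ioi (c₀ / 2) with hA
  have hcont := hP.continuousOn_opL_param hΩ
  have hO : IsOpen (Ω ∩ {p : E × (ℝ × ℝ) | p.2.1 ≠ 0}) :=
    hΩ.inter (isOpen_ne_fun (continuous_fst.comp continuous_snd) continuous_const)
  have hAo : IsOpen A := hcont.isOpen_inter_preimage hO isOpen_Ioi
  have hsub : ({(0 : E)} : Set E) ×ˢ K ⊆ A := by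
    rintro ⟨e, q⟩ ⟨he, hq⟩
    rw [mem_singleton_iff] at he
    subst he
    exact ⟨⟨hKΩ q hq, hK0 q hq⟩, lt_of_lt_of_le (by linarith) (hc q hq)⟩
  obtain ⟨u, w, hu, -, h0u, hKw, huw⟩ := generalized_tube_lemma isCompact_singleton hK hAo hsub
  have h0 : (0 : E) ∈ u := h0u (mem_singleton _)
  obtain ⟨ρ, hρ, hball⟩ := Metric.isOpen_iff.1 hu 0 h0
  refine ⟨ρ, hρ, fun e he q hq => ?_⟩
  have hmem : (e, q) ∈ A := huw ⟨hball (by simpa using he), hKw hq⟩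
  exact hmem.2

end Literature.Barriers.NavierStokesRegularity
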